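import Summits.BirchSwinnertonDyer.Rank1Residual.AdditivePotMult.ClassTheorems
import Summits.BirchSwinnertonDyer.Rank1Residual.P2.HeegnerIndexAtTwoOverK
import HarnessLib

/-!
# Sub-lane «bsd-p2»: descent to `ℚ` from the exact `K`-side Gross–Zagier index identity —
# granted `ord_p(4·I²/(c²·w²·c_K)) = ord_p #Ш(E_K/K)`, the pair `{E, E^{(d_K)}}` closes at `p`
# from EITHER member: `BSD(E, p) ⟺ BSD(E^{(d_K)}, p)` ("subtract the rank-0 member" as a theorem)

HONEST FRAMING (sub-lane «bsd-p2», run/shared/lean/b2b/bsd-rank1-residual/p2/, verbatim in every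
file): the target of record is the FULL Birch–Swinnerton-Dyer formula for EVERY analytic-rank `≤ 1`
`E/ℚ` at ALL primes INCLUDING `2`; the odd-prime class ledger is referee A's; the `2`-part is OPEN
(cells O1 = X5 ∖ CM and O12 = the CM corner) and under census by «bsd-p2». Census / instrument
output at `2` = EVIDENCE / conjecture items with held-out validation, NEVER a Literature fact;
certificates close PAIRS (one isogeny class, `p = 2`), never classes. This file asserts NO
arithmetic fact. PUBLISHED inputs as explicit binders: Milne 1972 Thm 1 (Weil restriction, in
Dokchitser–Dokchitser's quotient form, `Milne1972.bsdQuotient_baseChange_quadratic`),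
Gross–Zagier–Kolyvagin over `ℚ` (`rank_eq_analyticRank_of_analyticRank_le_one`), modularity
(`hasEntireLFunction_rat`), and for the last theorem Gross–Zagier `gross_zagier` + Kolyvagin
`kolyvagin` through `P2/HeegnerIndexAtTwoOverK.lean`. WHAT THIS FILE ADDS to additive-p1's
base-change-and-descend theorem `AdditivePotMult.bsdp_of_pPartOver_of_bsdp_twist'`
(`K`-side `p`-part ∧ `BSD(E^{(d_K)},p) ⇒ BSD(E,p)`, any `p`): the REVERSE direction
(`K`-side `p`-part ∧ `BSD(E,p) ⇒ BSD(E^{(d_K)},p)`, same identity (★) with the roles exchanged), hence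
the EQUIVALENCE `BSD(E,p) ⟺ BSD(E^{(d_K)},p)` granted the `K`-side `p`-part, and its instantiation by
the exact `K`-side Gross–Zagier index identity: granted ONE `p`-adic valuation identity over `K`,
the two members of a Heegner pair `{E, E^{(d_K)}}` (analytic ranks `{0,1}` in either order) have
EQUIVALENT `BSD(·, p)`. At `p = 2` this is the §0 K-c / K-d step of the 2-adic transport ideation
(HOME/p2/idea-2/ROUTES.md: "a₂(E) + a₂(E^{(d_K)}) exact; subtract the rank-0 member") as a kernel
object: a BASE PAIR is closed at `2` by ONE certified member (the rank-`0` one by the exact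
`L(E,1)/Ω` engine, `P2/RankZeroSpecAtTwo.lean`; or the rank-`1` one by `P2/HeegnerIndexAtTwo.lean`)
plus the `K`-side valuation check (index of `P_K` in `E(K)`, Manin constant, `w_K`, Tamagawa
numbers of `E_K`, `#Ш(E_K/K)[2^∞]`). The model `W.baseChange K` must be globally minimal over `K`
for Milne's identity to be the BSD quotient of `E_K` (instance binder; it holds when `W` is
`ℤ`-minimal and `gcd(d_K, N) = 1` — a minimal equation stays minimal at primes unramified in `K`
and at ramified primes of good reduction; not re-proved here, certified per pair by Tate's
algorithm over `K`). Per-pair statements; they close no class. Nothing booked; no mark moved. Unit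
`b2b-bsdres-p2-typer` GEN 3; NEW file.

References: Milne, Invent. Math. 17 (1972) Thm 1 [Milne1972ArithmeticAV]; Dokchitser–Dokchitser,
Ann. of Math. 172 (2010) §2.1 [DokchitserDokchitserAnnals2010]; Gross–Zagier 1986 V.(2.2)
[GrossZagier1986]; Kolyvagin 1990 Thm A [Kolyvagin1990]; Miller 2011 Def 1.1 [Miller2011LMS];
Zhang, Camb. J. Math. 2 (2014) proof of Thm 10.3 and Jetchev–Skinner–Wan 2017 §7.3–7.4 (the descent
in print, up to units); HOME/p2/idea-2/ROUTES.md §0 K-c, K-d; HOME/p2/LEAD-OKS.md L2-6.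
-/

noncomputable section

open scoped Classical

open WeierstrassCurve NumberField Literature.NumberTheory.EllipticCurves
  Literature.NumberTheory.EllipticCurves.ModularForms
  Literature.NumberTheory.EllipticCurves.Rank1Residual
  Literature.NumberTheory.EllipticCurves.Rank1Residual.Typed
  Literature.NumberTheory.EllipticCurves.KrizLi2019
  Literature.NumberTheory.QuadraticFields
  Summit.BirchSwinnertonDyer.Rank1Residual.AdditivePotMult

set_option autoImplicit false

namespace Summit.BirchSwinnertonDyer.Rank1Residual.P2

/-! ## Descent to `ℚ`: the pair `{E, E^{(d_K)}}` closes at `p` from EITHER member -/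

section Descent

variable (W : WeierstrassCurve ℚ) [W.IsElliptic] [W.IsGloballyMinimal] (p : ℕ) [Fact p.Prime]
  (K : Type) [Field K] [NumberField K] [(W.baseChange K).IsGloballyMinimal]
  (Wd : WeierstrassCurve ℚ) [Wd.IsElliptic] [Wd.IsGloballyMinimal]

/-- **THE TWIST SIDE OF THE DESCENT (reverse direction of additive-p1's
`bsdp_of_pPartOver_of_bsdp_twist`).** `W/ℚ` globally minimal of analytic rank `≤ 1`, `K` quadratic,
`Wd` a globally minimal model of `W^{(d_K)}` of analytic rank `≤ 1`, `W.baseChange K` globally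
minimal over `K`: the `K`-side input `MissingPPartOverAt (W.baseChange K) p` together with
`BSD(W, p)` implies `BSD(Wd, p)`. Same bookkeeping as the tree's theorem with the roles of `W` and
`Wd` exchanged in the identity (★) `#Ш_an(E_K)·#Ш(W)·#Ш(Wd) = #Ш_an(W)·#Ш_an(Wd)·#Ш(E_K)`
(`shaAnOver_mul_eq`; Milne's Weil-restriction identity `hMilne`, GZK `hGZK`, modularity `hmod`).
[cite: Milne1972ArithmeticAV, §1 Thm. 1] [cite: Miller2011LMS, Def. 1.1] -/
theorem bsdp_twist_of_pPartOver_of_bsdp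
    (hGZK : rank_eq_analyticRank_of_analyticRank_le_one) (hmod : hasEntireLFunction_rat)
    (hMilne : Milne1972.bsdQuotient_baseChange_quadratic)
    (hr : W.analyticRank ≤ 1) (h2 : Module.finrank ℚ K = 2)
    (hWd : ∃ C : VariableChange ℚ, C • W.quadraticTwist (NumberField.discr K : ℚ) = Wd)
    (hrd : Wd.analyticRank ≤ 1)
    (hK : MissingPPartOverAt (W.baseChange K) p) (hW : BSDp W p) : BSDp Wd p := by
  haveI hEK : (W.baseChange K).IsElliptic := isElliptic_baseChange' W K
  obtain ⟨-, hfinW⟩ := hGZK W hr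
  obtain ⟨-, hfinD⟩ := hGZK Wd hrd
  haveI : Finite W.sha := hfinW
  haveI : Finite Wd.sha := hfinD
  have hW' : ∃ C : VariableChange K, C • W.baseChange K = W.baseChange K := ⟨1, one_smul _ _⟩
  obtain ⟨hshaK, hWR⟩ := hMilne W K h2 Wd hWd (W.baseChange K) hW' hfinW hfinD
  -- the two inputs, in Miller's currency
  obtain ⟨qW, hqW, hvW⟩ := missingPPartAt_of_bsdp W p hW
  obtain ⟨q', hq', hv'⟩ := hK
  -- (★)
  have hstar := shaAnOver_mul_eq W K Wd (W.baseChange K) hmod h2 hWd hW' hfinW hfinD hshaK hWR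
  -- non-vanishing
  have hsW : W.shaOrder ≠ 0 := (W.shaOrder_pos hfinW).ne'
  have hsD : Wd.shaOrder ≠ 0 := (Wd.shaOrder_pos hfinD).ne'
  have hsK : (W.baseChange K).shaOrder ≠ 0 := ((W.baseChange K).shaOrder_pos hshaK).ne'
  have hshaAn_ne : ∀ (V : WeierstrassCurve ℚ) [V.IsElliptic], shaAn V ≠ 0 := by
    intro V _ h
    rw [shaAn_def, div_eq_zero_iff] at h
    rcases h with h | h
    · rcases mul_eq_zero.mp h with h | h
      · exact V.leadingLCoeff_ne_zero_holds (hmod V) h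
      · exact (pow_ne_zero 2 (by exact_mod_cast V.torsionOrder_pos_holds.ne' :
          (V.torsionOrder : ℂ) ≠ 0)) h
    · rcases mul_eq_zero.mp h with h | h
      · rcases mul_eq_zero.mp h with h | h
        · exact (by exact_mod_cast V.realPeriodRat_pos_holds.ne' : (V.realPeriodRat : ℂ) ≠ 0) h
        · exact (by exact_mod_cast V.tamagawaProduct_pos_holds.ne' :
            (V.tamagawaProduct : ℂ) ≠ 0) h
      · exact (by exact_mod_cast V.regulator_pos'.ne' : (V.regulator : ℂ) ≠ 0) h
  have hqW0 : qW ≠ 0 := by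
    intro h0; exact hshaAn_ne W (by rw [hqW, h0, Rat.cast_zero])
  have hq'0 : q' ≠ 0 := by
    intro h0
    have : shaAn W * shaAn Wd * ((W.baseChange K).shaOrder : ℂ) = 0 := by
      rw [← hstar, hq', h0]; simp
    rcases mul_eq_zero.mp this with h | h
    · rcases mul_eq_zero.mp h with h | h
      · exact hshaAn_ne W h
      · exact hshaAn_ne Wd h
    · exact hsK (by exact_mod_cast h)
  -- solve (★) for `#Ш_an(Wd)`
  set q : ℚ := q' * W.shaOrder * Wd.shaOrder / ((W.baseChange K).shaOrder * qW) with hq_def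
  have hshaAn : shaAn Wd = (q : ℂ) := by
    have hden : ((W.baseChange K).shaOrder : ℂ) * (qW : ℂ) ≠ 0 :=
      mul_ne_zero (by exact_mod_cast hsK) (by exact_mod_cast hqW0)
    have hqWc : (qW : ℂ) ≠ 0 := by exact_mod_cast hqW0
    rw [hq_def]
    push_cast
    rw [eq_div_iff hden, ← hqW, ← hq']
    linear_combination -hstar
  refine bsdp_of_missingPPartAt Wd p hGZK hrd ⟨q, hshaAn, ?_⟩
  -- valuations
  have hsWq : (W.shaOrder : ℚ) ≠ 0 := by exact_mod_cast hsW
  have hsDq : (Wd.shaOrder : ℚ) ≠ 0 := by exact_mod_cast hsD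
  have hsKq : ((W.baseChange K).shaOrder : ℚ) ≠ 0 := by exact_mod_cast hsK
  rw [hq_def, padicValRat.div (mul_ne_zero (mul_ne_zero hq'0 hsWq) hsDq) (mul_ne_zero hsKq hqW0),
    padicValRat.mul (mul_ne_zero hq'0 hsWq) hsDq, padicValRat.mul hq'0 hsWq,
    padicValRat.mul hsKq hqW0, hv', hvW, padicValRat.of_nat, padicValRat.of_nat, padicValRat.of_nat]
  ring

/-- **THE PAIR CLOSES FROM EITHER MEMBER.** `W/ℚ` globally minimal, `K` quadratic, `Wd` a globally
minimal model of `W^{(d_K)}`, both of analytic rank `≤ 1`, `W.baseChange K` globally minimal over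
`K`, and the `K`-side `p`-part `MissingPPartOverAt (W.baseChange K) p` (e.g. discharged by the
valuation identity of `missingPPartOverAt_baseChange_iff_of_heegner` /
`missingPPartOverAt_baseChange_iff_of_caiShuTian`): THEN `BSD(W, p) ⟺ BSD(Wd, p)` — forward by
`bsdp_twist_of_pPartOver_of_bsdp`, backward by additive-p1's `bsdp_of_pPartOver_of_bsdp_twist'`.
At `p = 2`: a BASE PAIR `{E, E^{(d_K)}}` (ranks `{0,1}`) of the transport ideation is closed at `2`
by ONE certified member plus the `K`-side check ("subtract the rank-0 member", ROUTES.md §0 K-c).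
Binders: `hGZK`, `hmod`, `hMilne`. A per-pair statement; it closes no class.
[cite: Milne1972ArithmeticAV, §1 Thm. 1] [cite: GrossZagier1986, V.(2.2)] [cite: Miller2011LMS, Def. 1.1] -/
theorem bsdp_iff_bsdp_twist_of_pPartOver
    (hGZK : rank_eq_analyticRank_of_analyticRank_le_one) (hmod : hasEntireLFunction_rat)
    (hMilne : Milne1972.bsdQuotient_baseChange_quadratic)
    (hr : W.analyticRank ≤ 1) (h2 : Module.finrank ℚ K = 2)
    (hWd : ∃ C : VariableChange ℚ, C • W.quadraticTwist (NumberField.discr K : ℚ) = Wd)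
    (hrd : Wd.analyticRank ≤ 1) (hK : MissingPPartOverAt (W.baseChange K) p) :
    BSDp W p ↔ BSDp Wd p := by
  haveI hEK : (W.baseChange K).IsElliptic := isElliptic_baseChange' W K
  exact ⟨bsdp_twist_of_pPartOver_of_bsdp W p K Wd hGZK hmod hMilne hr h2 hWd hrd hK,
    bsdp_of_pPartOver_of_bsdp_twist' W p K Wd (W.baseChange K) hGZK hmod hMilne hr h2 hWd hrd
      ⟨1, one_smul _ _⟩ hK⟩

/-- **`BSD(E, p)` FROM THE `K`-SIDE VALUATION IDENTITY AND THE TWIN (classical Heegner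
hypothesis).** In the setting of `shaAnOver_baseChange_eq_heegnerIndex_sq` with `W`, `Wd`
globally minimal over `ℚ` and `W.baseChange K` globally minimal over `K`: if
`ord_p(4·I²/(c²·w²·c_K)) = ord_p #Ш(E_K/K)` then `BSD(Wd, p) → BSD(W, p)` AND `BSD(W, p) → BSD(Wd, p)`.
So for the rank-one member `E` of the pair the inputs are: the twin's `BSD(E^{(d_K)}, p)` (rank `0`:
exact `L/Ω`, `P2/RankZeroSpecAtTwo.lean` at `p = 2`), the index of `P_K` in `E(K)`, `c`, `w`, the
Tamagawa numbers of `E_K` and `#Ш(E_K/K)[p^∞]` — and NOT the halvability bit, `c_∞`, `#E(ℚ)_tor`,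
`#E(K)_tor` or the minimalising scalar of the twist (contrast `bsdp_two_iff_of_heegner_rankOne`).
Binders: `hGZ`, `hKo`, `hGZK`, `hmod`, `hMilne`. [cite: GrossZagier1986, Thm. I.6.3 and V.(2.2)]
[cite: Kolyvagin1990, Thm. A] [cite: Milne1972ArithmeticAV, §1 Thm. 1] [cite: Miller2011LMS, Def. 1.1] -/
theorem bsdp_iff_bsdp_twist_of_heegnerIndexOverK
    (N : ℕ) [NeZero N]
    (Dt : ModularParametrizationData W N) (H : HeegnerDatum N (NumberField.discr K)) (ι : K →+* ℂ)
    (P : (W.baseChange K).toAffine.Point)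
    (hGZ : gross_zagier N W K) (hKo : kolyvagin N W K)
    (hGZK : rank_eq_analyticRank_of_analyticRank_le_one) (hmod : hasEntireLFunction_rat)
    (hMilne : Milne1972.bsdQuotient_baseChange_quadratic)
    (hK : IsImaginaryQuadratic K) (hHN : SatisfiesHeegnerHypothesis N K)
    (hP : WeierstrassCurve.Affine.Point.map ι.toRatAlgHom P = heegnerPointComplex Dt H)
    (hc0 : Dt.c ≠ 0) (hr : (W.baseChange K).analyticRank = 1)
    (hWd : ∃ C : VariableChange ℚ, C • W.quadraticTwist (NumberField.discr K : ℚ) = Wd)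
    (hv : padicValRat p
          (4 * ((AddSubgroup.zmultiples P).index : ℚ) ^ 2 /
            ((Dt.c : ℚ) ^ 2 * (Units.torsionOrder K : ℚ) ^ 2 *
              ((W.baseChange K).tamagawaProduct : ℚ))) =
        padicValNat p (W.baseChange K).shaOrder) :
    BSDp W p ↔ BSDp Wd p := by
  have h2 : Module.finrank ℚ K = 2 := hK.1
  have hD0 : (NumberField.discr K : ℚ) ≠ 0 := by exact_mod_cast NumberField.discr_ne_zero K
  haveI hEt : (W.quadraticTwist (NumberField.discr K : ℚ)).IsElliptic :=
    W.isElliptic_quadraticTwist hD0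
  have hranks := (analyticRank_baseChange_eq_one_iff W K hmod h2).mp hr
  have hrW : W.analyticRank ≤ 1 := by rcases hranks with ⟨h, -⟩ | ⟨h, -⟩ <;> omega
  have hrd : Wd.analyticRank ≤ 1 := by
    obtain ⟨Cd, hCd⟩ := hWd
    rw [← hCd, analyticRank_smul]
    rcases hranks with ⟨-, h⟩ | ⟨-, h⟩ <;> omega
  have hKside : MissingPPartOverAt (W.baseChange K) p :=
    (missingPPartOverAt_baseChange_iff_of_heegner W N K Dt H ι P p hGZ hKo hmod hK hHN hP hc0
      hr).mpr hv
  exact bsdp_iff_bsdp_twist_of_pPartOver W p K Wd hGZK hmod hMilne hrW h2 hWd hrd hKside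

end Descent

end Summit.BirchSwinnertonDyer.Rank1Residual.P2

end
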